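import Mathlib.Analysis.InnerProductSpace.PiL2
import Mathlib.MeasureTheory.Measure.Haar.InnerProductSpace
import Mathlib.MeasureTheory.Measure.Lebesgue.Basic
import Literature.MathematicalPhysics.QuantumFieldTheory.Balaban1983to89.B4Eq19LatticeOperators
import HarnessLib

/-!
# LINE 25 «CompactnessTransfer» (crux `HistoryTailL` stmt-QuantumFields-19936 ∕ K2 crux `BlockLipschitzL` stmt-QuantumFields-23533), S2′ infrastructure (Γ1),
# FILE M2a: THE TWO-GRID CELLS `{⌊R x⌋ = a, ⌊R(x − y)⌋ = a − w}` OF A TRANSLATED PIECEWISE-CONSTANT BLOW-DOWN — volume `Π_i (R⁻¹ − |yᵢ − wᵢ∕R|)₊ ≤ R⁻³`,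
# the SLAB BOUND `(R⁻¹ − |yᵢ − wᵢ∕R|)·|wᵢ| ≤ 2|yᵢ|`, and the index shifts `w ∈ {⌊R y⌋, ⌈R y⌉}³`

Cell `ym3-torus` (YM ladder rung R3 = continuum SU(2) Yang–Mills on the three-torus — a RUNG, NOT the Clay problem: not d = 4, not infinite volume, not a mass gap);
width seat `ym3-torus-px3` gen 7, the Γ1 seat (road of record 11:24Z: (c3) of `blowDown_L2_compact` BY NAME through lit ✓`Literature.Analysis.FunctionSpaces.
exists_finset_eLpNorm_sub_lt_of_translate`, which asks for the UNIFORM `L²`-translation modulus of the blow-downs; FILE M1 = its lattice half, this file + M2b = its measure half).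
THEOREMS ONLY (def-free); `--supports` the K2 crux as a helper.  Nothing here proves Γ1, S2′, the organ, `BlockLipschitzL`, `HistoryTailL` or any summit statement.

WHY.  Translating `x ↦ v(⌊R x⌋)` by `y` and subtracting, the difference is constant on each TWO-GRID CELL `T(a, w) = {x : ⌊R x⌋ = a, ⌊R(x − y)⌋ = a − w}` — a product of
intervals `[aᵢ∕R, (aᵢ+1)∕R) ∩ ([(aᵢ−wᵢ)∕R, (aᵢ−wᵢ+1)∕R) + yᵢ)` of length `ℓᵢ = (R⁻¹ − |yᵢ − wᵢ∕R|)₊`, INDEPENDENT of `a`.  Two facts make the modulus uniform in `R`: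
`ℓᵢ ≤ R⁻¹` (a cell) and the SLAB BOUND `ℓᵢ·|wᵢ| ≤ 2|yᵢ|` (for `|R yᵢ| < 1` the shift `wᵢ = ±1` only happens on a slab of width `|yᵢ|`; for `|R yᵢ| ≥ 1`, `|wᵢ| ≤ R|yᵢ| + 1 ≤ 2R|yᵢ|`);
and only the `≤ 8` shifts `w` with `wᵢ ∈ {⌊R yᵢ⌋, ⌈R yᵢ⌉}` occur.
* §1 `sub_coord` (`(x − y) i = x i − y i` on `EuclideanSpace`), `twoGridCell_eq_preimage_pi`, `measurableSet_twoGridCell`, ★ `volume_twoGridCell_le`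
  (`≤ ofReal (Π_i max 0 (R⁻¹ − |yᵢ − wᵢ∕R|))`).
* §2 ★ `slab_bound` (`(1 − |s − w|)·|w| ≤ 2|s|` for `w = 0 ∨ 1 ≤ |w|`), `cellLength_nonneg∕_le_inv∕_mul_abs_le`.
* §3 shifts: `mem_floor_ceil_of_abs_sub_lt_one`, `floor_sub_floor_mem_shifts`, `abs_le_of_mem_shifts` (`|wᵢ| ≤ R|yᵢ| + 1`), `card_shifts_le` (`≤ 8`).
[folklore] ([AlicandroCicalese2008] §2; [Adams1975] Thm 2.21 (translation condition); the statements and proofs are elementary).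
-/

set_option autoImplicit false

noncomputable section

open scoped BigOperators ENNReal
open MeasureTheory Set Finset

namespace Summit.QuantumFields.YangMills.Theorems.PoincareLipschitzTwoGridCells

open Literature.MathematicalPhysics.QuantumFieldTheory.Balaban1983to89
open B4Eq19LatticeOperators (Zd)

/-! ## §1 The two-grid cells -/

/-- Coordinates of a difference in `EuclideanSpace ℝ (Fin 3)`. [folklore] -/
theorem sub_coord (x y : EuclideanSpace ℝ (Fin 3)) (i : Fin 3) : (x - y) i = x i - y i := by
  rfl

/-- For `R > 0` the two-grid cell `{⌊R x⌋ = a, ⌊R(x − y)⌋ = a − w}` is the preimage of the product of the intervals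
`[max (aᵢ∕R) ((aᵢ−wᵢ)∕R + yᵢ), min ((aᵢ+1)∕R) ((aᵢ−wᵢ+1)∕R + yᵢ))`. [folklore] -/
theorem twoGridCell_eq_preimage_pi {R : ℝ} (hR : 0 < R) (y : EuclideanSpace ℝ (Fin 3)) (a w : Zd 3) :
    {x : EuclideanSpace ℝ (Fin 3) | (∀ i, ⌊R * x i⌋ = a i) ∧ (∀ i, ⌊R * (x i - y i)⌋ = a i - w i)}
      = (WithLp.ofLp : EuclideanSpace ℝ (Fin 3) → (Fin 3 → ℝ)) ⁻¹'
          (Set.pi Set.univ fun i => Set.Ico (max ((a i : ℝ) / R) (((a i : ℝ) - w i) / R + y i))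
            (min (((a i : ℝ) + 1) / R) (((a i : ℝ) - w i + 1) / R + y i))) := by
  ext x
  simp only [Set.mem_setOf_eq, Set.mem_preimage, Set.mem_pi, Set.mem_univ, true_implies, Set.mem_Ico, max_le_iff, lt_min_iff,
    ← forall_and]
  refine forall_congr' fun i => ?_
  rw [Int.floor_eq_iff, Int.floor_eq_iff, div_le_iff₀ hR, lt_div_iff₀ hR, Int.cast_sub]
  constructor
  · rintro ⟨⟨h1, h2⟩, h3, h4⟩
    refine ⟨⟨by linarith, ?_⟩, by linarith, ?_⟩
    · rw [div_add' _ _ _ hR.ne', div_le_iff₀ hR]; nlinarith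
    · rw [div_add' _ _ _ hR.ne', lt_div_iff₀ hR]; nlinarith
  · rintro ⟨⟨h1, h2⟩, h3, h4⟩
    rw [div_add' _ _ _ hR.ne', div_le_iff₀ hR] at h2
    rw [div_add' _ _ _ hR.ne', lt_div_iff₀ hR] at h4
    refine ⟨⟨by linarith, by linarith⟩, by nlinarith, by nlinarith⟩

/-- The two-grid cell is measurable. [folklore] -/
theorem measurableSet_twoGridCell {R : ℝ} (hR : 0 < R) (y : EuclideanSpace ℝ (Fin 3)) (a w : Zd 3) :
    MeasurableSet {x : EuclideanSpace ℝ (Fin 3) | (∀ i, ⌊R * x i⌋ = a i) ∧ (∀ i, ⌊R * (x i - y i)⌋ = a i - w i)} := by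
  rw [twoGridCell_eq_preimage_pi hR y a w]
  exact (MeasurableSet.univ_pi fun i => measurableSet_Ico).preimage (PiLp.volume_preserving_ofLp (Fin 3)).measurable

/-- `min (α + c) (β + c) − max α β = c − |α − β|`. [folklore] -/
theorem min_add_sub_max_eq (α β c : ℝ) : min (α + c) (β + c) - max α β = c - |α - β| := by
  rcases le_total α β with h | h
  · rw [min_eq_left (by linarith), max_eq_right h, abs_of_nonpos (by linarith)]; ring
  · rw [min_eq_right (by linarith), max_eq_left h, abs_of_nonneg (by linarith)]; ring

/-- The side lengths of the two-grid cell: `hiᵢ − loᵢ = R⁻¹ − |yᵢ − wᵢ∕R|`, independent of `a`. [folklore] -/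
theorem twoGridCell_side (R : ℝ) (y : EuclideanSpace ℝ (Fin 3)) (a w : Zd 3) (i : Fin 3) :
    min (((a i : ℝ) + 1) / R) (((a i : ℝ) - w i + 1) / R + y i) - max ((a i : ℝ) / R) (((a i : ℝ) - w i) / R + y i)
      = R⁻¹ - |y i - (w i : ℝ) / R| := by
  have e1 : ((a i : ℝ) + 1) / R = (a i : ℝ) / R + R⁻¹ := by rw [add_div, one_div]
  have e2 : ((a i : ℝ) - w i + 1) / R + y i = (((a i : ℝ) - w i) / R + y i) + R⁻¹ := by rw [add_div, one_div]; ring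
  rw [e1, e2, min_add_sub_max_eq]
  congr 1
  rw [show (a i : ℝ) / R - (((a i : ℝ) - w i) / R + y i) = -(y i - (w i : ℝ) / R) by rw [sub_div]; ring, abs_neg]

/-- ★ **VOLUME OF THE TWO-GRID CELL**: `volume {⌊R x⌋ = a, ⌊R(x − y)⌋ = a − w} ≤ ofReal (Π_i max 0 (R⁻¹ − |yᵢ − wᵢ∕R|))` (in fact equality; independent of `a`).
[folklore] -/
theorem volume_twoGridCell_le {R : ℝ} (hR : 0 < R) (y : EuclideanSpace ℝ (Fin 3)) (a w : Zd 3) :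
    volume {x : EuclideanSpace ℝ (Fin 3) | (∀ i, ⌊R * x i⌋ = a i) ∧ (∀ i, ⌊R * (x i - y i)⌋ = a i - w i)}
      ≤ ENNReal.ofReal (∏ i : Fin 3, max 0 (R⁻¹ - |y i - (w i : ℝ) / R|)) := by
  rw [twoGridCell_eq_preimage_pi hR y a w, (PiLp.volume_preserving_ofLp (Fin 3)).measure_preimage
    (MeasurableSet.univ_pi fun i => measurableSet_Ico).nullMeasurableSet, Real.volume_pi_Ico,
    ENNReal.ofReal_prod_of_nonneg (fun i _ => le_max_left _ _)]
  refine le_of_eq (Finset.prod_congr rfl fun i _ => ?_)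
  rw [twoGridCell_side R y a w i]
  rcases le_total 0 (R⁻¹ - |y i - (w i : ℝ) / R|) with h | h
  · rw [max_eq_right h]
  · rw [max_eq_left h, ENNReal.ofReal_of_nonpos h, ENNReal.ofReal_zero]

/-! ## §2 The slab bound -/

/-- ★ **THE SLAB BOUND**: `(1 − |s − w|)·|w| ≤ 2|s|` whenever `w = 0` or `|w| ≥ 1` (in particular for integer `w`). [folklore] -/
theorem slab_bound (s w : ℝ) (hw : w = 0 ∨ 1 ≤ |w|) : (1 - |s - w|) * |w| ≤ 2 * |s| := by
  rcases hw with hw | hw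
  · subst hw; simp [abs_nonneg]
  · by_cases h : 1 ≤ |s - w|
    · nlinarith [abs_nonneg w, abs_nonneg s]
    · push Not at h
      have hws : |w| ≤ |s| + |s - w| := by
        have := abs_sub_abs_le_abs_sub w s; rw [abs_sub_comm] at this; linarith
      by_cases hs : 1 ≤ |s|
      · -- `(1 − |s − w|)|w| ≤ |w| < |s| + 1 ≤ 2|s|`
        have h1 : (1 - |s - w|) * |w| ≤ |w| := by nlinarith [abs_nonneg (s - w), abs_nonneg w]
        linarith
      · push Not at hs
        -- `1 − |s − w| ≤ |s| + 1 − |w| ≤ |s|` and `|w| < |s| + 1 < 2`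
        have h1 : 1 - |s - w| ≤ |s| := by linarith
        have h2 : 0 ≤ 1 - |s - w| := by linarith
        calc (1 - |s - w|) * |w| ≤ |s| * |w| := mul_le_mul_of_nonneg_right h1 (abs_nonneg w)
          _ ≤ |s| * (|s| + 1) := mul_le_mul_of_nonneg_left (by linarith) (abs_nonneg s)
          _ ≤ 2 * |s| := by nlinarith [abs_nonneg s]

/-- The cell length `ℓᵢ = max 0 (R⁻¹ − |yᵢ − wᵢ∕R|)` is non-negative. [folklore] -/
theorem cellLength_nonneg (R t u : ℝ) : 0 ≤ max 0 (R⁻¹ - |t - u / R|) := le_max_left _ _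

/-- The cell length is at most `R⁻¹`. [folklore] -/
theorem cellLength_le_inv {R : ℝ} (hR : 0 < R) (t u : ℝ) : max 0 (R⁻¹ - |t - u / R|) ≤ R⁻¹ :=
  max_le (inv_nonneg.2 hR.le) (by linarith [abs_nonneg (t - u / R)])

/-- ★ **The slab bound for the cell length**: `max 0 (R⁻¹ − |t − w∕R|) · |w| ≤ 2|t|` for integer `w` and `R > 0`. [folklore] -/
theorem cellLength_mul_abs_le {R : ℝ} (hR : 0 < R) (t : ℝ) (w : ℤ) : max 0 (R⁻¹ - |t - (w : ℝ) / R|) * |(w : ℝ)| ≤ 2 * |t| := by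
  have hw : (w : ℝ) = 0 ∨ 1 ≤ |(w : ℝ)| := by
    by_cases h : w = 0
    · left; exact_mod_cast h
    · right; exact_mod_cast Int.one_le_abs h
  have key := slab_bound (R * t) w hw
  -- `R⁻¹ − |t − w∕R| = R⁻¹ (1 − |R t − w|)`
  have e : R⁻¹ - |t - (w : ℝ) / R| = R⁻¹ * (1 - |R * t - w|) := by
    have : t - (w : ℝ) / R = R⁻¹ * (R * t - w) := by field_simp
    rw [this, abs_mul, abs_of_pos (inv_pos.2 hR)]; ring
  rcases le_or_gt (R⁻¹ - |t - (w : ℝ) / R|) 0 with h0 | h0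
  · rw [max_eq_left h0, zero_mul]; positivity
  · rw [max_eq_right h0.le, e, mul_assoc]
    calc R⁻¹ * ((1 - |R * t - ↑w|) * |(w : ℝ)|) ≤ R⁻¹ * (2 * |R * t|) := mul_le_mul_of_nonneg_left key (inv_nonneg.2 hR.le)
      _ = 2 * |t| := by rw [abs_mul, abs_of_pos hR]; field_simp

/-! ## §3 The shifts `w ∈ {⌊R y⌋, ⌈R y⌉}³` -/

/-- An integer within distance `< 1` of a real `s` is `⌊s⌋` or `⌈s⌉`. [folklore] -/
theorem mem_floor_ceil_of_abs_sub_lt_one {s : ℝ} {n : ℤ} (h : |(n : ℝ) - s| < 1) : n = ⌊s⌋ ∨ n = ⌈s⌉ := by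
  rw [abs_lt] at h
  rcases le_or_gt (n : ℝ) s with hle | hlt
  · left; symm; rw [Int.floor_eq_iff]; constructor <;> linarith
  · right; symm; rw [Int.ceil_eq_iff]; constructor <;> linarith

/-- The shift between the two grids: `⌊R t⌋ − ⌊R(t − s)⌋ ∈ {⌊R s⌋, ⌈R s⌉}`. [folklore] -/
theorem floor_sub_floor_mem_shifts (R t s : ℝ) :
    ⌊R * t⌋ - ⌊R * (t - s)⌋ ∈ ({⌊R * s⌋, ⌈R * s⌉} : Finset ℤ) := by
  have h : |((⌊R * t⌋ - ⌊R * (t - s)⌋ : ℤ) : ℝ) - R * s| < 1 := by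
    rw [abs_lt, Int.cast_sub]
    have h1 := Int.floor_le (R * t)
    have h2 := Int.lt_floor_add_one (R * t)
    have h3 := Int.floor_le (R * (t - s))
    have h4 := Int.lt_floor_add_one (R * (t - s))
    constructor <;> nlinarith
  rcases mem_floor_ceil_of_abs_sub_lt_one h with h' | h'
  · rw [h']; simp
  · rw [h']; simp

/-- The shift vector of the two grids lies in the finite set `Π_i {⌊R yᵢ⌋, ⌈R yᵢ⌉}`. [folklore] -/
theorem floorVec_sub_mem_shifts (R : ℝ) (x y : EuclideanSpace ℝ (Fin 3)) :
    ((fun i => ⌊R * x i⌋) - fun i => ⌊R * (x i - y i)⌋ : Zd 3) ∈ Fintype.piFinset fun i => ({⌊R * y i⌋, ⌈R * y i⌉} : Finset ℤ) := by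
  rw [Fintype.mem_piFinset]
  intro i
  exact floor_sub_floor_mem_shifts R (x i) (y i)

/-- For a shift `w ∈ Π_i {⌊R yᵢ⌋, ⌈R yᵢ⌉}`: `|wᵢ| ≤ R|yᵢ| + 1` (`R ≥ 0`). [folklore] -/
theorem abs_le_of_mem_shifts {R : ℝ} (hR : 0 ≤ R) (y : EuclideanSpace ℝ (Fin 3)) {w : Zd 3}
    (hw : w ∈ Fintype.piFinset fun i => ({⌊R * y i⌋, ⌈R * y i⌉} : Finset ℤ)) (i : Fin 3) :
    |(w i : ℝ)| ≤ R * |y i| + 1 := by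
  rw [Fintype.mem_piFinset] at hw
  have hi := hw i
  rw [Finset.mem_insert, Finset.mem_singleton] at hi
  have hRy : |R * y i| = R * |y i| := by rw [abs_mul, abs_of_nonneg hR]
  rw [← hRy, abs_le]
  rcases hi with h | h <;> rw [h]
  · have h1 := Int.floor_le (R * y i)
    have h2 := Int.lt_floor_add_one (R * y i)
    constructor <;> linarith [neg_abs_le (R * y i), le_abs_self (R * y i)]
  · have h1 := Int.le_ceil (R * y i)
    have h2 := Int.ceil_lt_add_one (R * y i)
    constructor <;> linarith [neg_abs_le (R * y i), le_abs_self (R * y i)]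

/-- At most `8` shifts. [folklore] -/
theorem card_shifts_le (R : ℝ) (y : EuclideanSpace ℝ (Fin 3)) :
    (Fintype.piFinset fun i => ({⌊R * y i⌋, ⌈R * y i⌉} : Finset ℤ)).card ≤ 8 := by
  rw [Fintype.card_piFinset]
  calc ∏ i : Fin 3, ({⌊R * y i⌋, ⌈R * y i⌉} : Finset ℤ).card ≤ ∏ _i : Fin 3, 2 :=
        Finset.prod_le_prod' fun i _ => Finset.card_le_two
    _ = 8 := by norm_num

end Summit.QuantumFields.YangMills.Theorems.PoincareLipschitzTwoGridCells

end
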